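import Summits.Ventures.HodgeRepro.RectQuadKK
import Summits.Ventures.HodgeRepro.RectQuadThreshold

/-!
# The two-generator rectangle's threshold `4k²` is SHARP — a kernel iff for the fifth mechanism

Blind re-derivation cell `pub-hodge-repro`, seat `p1` (gen 11).  Gen 10 proved the SUFFICIENCY half of the fifth
mechanism (`RectQuadKK.lean`): an injective `ψ : ℤ/2 × ℤ/k × ℤ/k →* G` with `ψ(1,0,0) = c` and `4k² ≤ |G|` gives a
CM type whose twists by `ψ(1,1,0), ψ(1,0,1), ψ(0,1,1)` are `SumTwo` without a conjugate pair.  Route-2 g30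
(INBOX L1130, «Theorem B», paper + exhaustive enumeration) observed that the threshold is necessary; this file is
the kernel form, in the style of gen 10's `RectQuadThreshold.lean` (the `8k` threshold of the fourth mechanism):

* `four_mul_sq_le_card_of_rectQuad_kk` — such a quadruple forces `4k² ≤ |G|` (no parity or size hypothesis on `k`);
* `exists_rectQuad_kk_iff` — for `k ≥ 3` the mechanism exists IFF `4k² ≤ |G|`.

Proof.  Lagrange: `|im ψ| = 2k²` divides `|G|`, so `|G| < 4k²` forces `|G| = 2k²` and `ψ` bijective; read `Φ` as a
pattern `χ` on `W = ℤ/2 × ℤ/k × ℤ/k`.  The CM condition is the `ℤ/2`-flip, so `χ` is determined by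
`g(a, b) = χ(0, a, b) ∈ {0, 1}`, and the local `SumTwo` at `(0, a, b)` — the four translates are
`(0,a,b), (1,a−1,b), (1,a,b−1), (0,a−1,b−1)` — reads `g(a,b) + (1 − g(a−1,b)) + (1 − g(a,b−1)) + g(a−1,b−1) = 2`,
i.e. the MIXED DIFFERENCE `g(a,b) − g(a−1,b) − g(a,b−1) + g(a−1,b−1)` vanishes (`valKK_mixed`).  Hence
`D(a, b) = g(a,b) − g(a−1,b)` is independent of `b` (`valKK_diff_const`, induction along `b`), so
`E(a, b) = g(a,b) − g(0,b)` is independent of `b` (`valKK_sub_const`, induction along `a`): `g = α(a) + β(b)`.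
A `{0,1}`-valued `α(a) + β(b)` depends on `a` alone or on `b` alone (`valKK_dichotomy`: if some `E(a₀, ·) = ±1`
then `β` is forced constant).  Independent of `a` ⇒ `Φ ψ(1,1,0) = c • Φ` (pair `(0, 1)`); independent of `b` ⇒
`Φ ψ(1,0,1) = c • Φ` (pair `(0, 2)`) — `exists_conj_local_kk`.
-/

set_option autoImplicit false

open Finset
open scoped Pointwise

namespace HodgeRepro.CosetQuad

variable {G : Type*} [Group G]

/-! ### Booleans -/

/-- `toNat ≤ 1`. -/
theorem toNat_le_one' (b : Bool) : b.toNat ≤ 1 := by cases b <;> decide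

/-- `toNat` is injective. -/
theorem eq_of_toNat_eq {b c : Bool} (h : b.toNat = c.toNat) : b = c := by
  cases b <;> cases c <;> simp_all

section Local

variable (k : ℕ)

/-- The value of a pattern at `(0, a, b)`, as an integer in `{0, 1}`. -/
def valKK (χ : PKK k → Bool) (a b : ZMod k) : ℤ :=
  ((χ (1, Multiplicative.ofAdd a, Multiplicative.ofAdd b)).toNat : ℤ)

/-- `0 ≤ valKK ≤ 1`. -/
theorem valKK_bounds (χ : PKK k → Bool) (a b : ZMod k) : 0 ≤ valKK k χ a b ∧ valKK k χ a b ≤ 1 := by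
  unfold valKK
  have := toNat_le_one' (χ (1, Multiplicative.ofAdd a, Multiplicative.ofAdd b))
  omega

/-- The CM condition as the `ℤ/2`-flip: `χ(1, a, b) = ¬χ(0, a, b)`. -/
theorem chi_flip (χ : PKK k → Bool) (hcm : ∀ p : PKK k, χ (p * conjKK k) = !χ p)
    (a b : Multiplicative (ZMod k)) : χ (Multiplicative.ofAdd 1, a, b) = !χ (1, a, b) := by
  have h := hcm (1, a, b)
  rwa [show ((1 : Multiplicative (ZMod 2)), a, b) * conjKK k = (Multiplicative.ofAdd 1, a, b) from by
    show ((1 : Multiplicative (ZMod 2)), a, b) * (Multiplicative.ofAdd 1, 1, 1) = (Multiplicative.ofAdd 1, a, b)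
    simp only [Prod.mk_mul_mk, one_mul, mul_one]] at h

/-- `ofAdd a * ofAdd (-1) = ofAdd (a - 1)`. -/
theorem ofAdd_mul_ofAdd_neg_one (a : ZMod k) :
    Multiplicative.ofAdd a * Multiplicative.ofAdd (-1 : ZMod k) = Multiplicative.ofAdd (a - 1) := by
  rw [← ofAdd_add, sub_eq_add_neg]

/-- **The mixed-difference identity.**  The local `SumTwo` of the two-generator rectangle at `(0, a, b)` says
`g(a,b) − g(a−1,b) − g(a,b−1) + g(a−1,b−1) = 0`. -/
theorem valKK_mixed (χ : PKK k → Bool) (hcm : ∀ p : PKK k, χ (p * conjKK k) = !χ p)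
    (hst : ∀ p : PKK k, (univ.filter fun j : Fin 4 => χ (p * (twistKK k j)⁻¹) = true).card = 2)
    (a b : ZMod k) :
    valKK k χ a b - valKK k χ (a - 1) b - valKK k χ a (b - 1) + valKK k χ (a - 1) (b - 1) = 0 := by
  obtain ⟨h0, h1, h2, h3⟩ := mul_twistKK_inv k 1 (Multiplicative.ofAdd a) (Multiplicative.ofAdd b)
  rw [one_mul, zmod2_ofAdd_neg_one, ofAdd_mul_ofAdd_neg_one] at h1
  rw [one_mul, zmod2_ofAdd_neg_one, ofAdd_mul_ofAdd_neg_one] at h2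
  rw [ofAdd_mul_ofAdd_neg_one, ofAdd_mul_ofAdd_neg_one] at h3
  have h := hst (1, Multiplicative.ofAdd a, Multiplicative.ofAdd b)
  have hv : (univ.filter fun j : Fin 4 =>
      χ ((1, Multiplicative.ofAdd a, Multiplicative.ofAdd b) * (twistKK k j)⁻¹) = true) =
      univ.filter fun j : Fin 4 => ![χ (1, Multiplicative.ofAdd a, Multiplicative.ofAdd b),
        χ (Multiplicative.ofAdd 1, Multiplicative.ofAdd (a - 1), Multiplicative.ofAdd b),
        χ (Multiplicative.ofAdd 1, Multiplicative.ofAdd a, Multiplicative.ofAdd (b - 1)),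
        χ (1, Multiplicative.ofAdd (a - 1), Multiplicative.ofAdd (b - 1))] j = true := by
    apply Finset.filter_congr
    intro j _
    fin_cases j
    · show χ ((1, Multiplicative.ofAdd a, Multiplicative.ofAdd b) * (twistKK k 0)⁻¹) = true ↔
        χ (1, Multiplicative.ofAdd a, Multiplicative.ofAdd b) = true
      rw [h0]
    · show χ ((1, Multiplicative.ofAdd a, Multiplicative.ofAdd b) * (twistKK k 1)⁻¹) = true ↔
        χ (Multiplicative.ofAdd 1, Multiplicative.ofAdd (a - 1), Multiplicative.ofAdd b) = true
      rw [h1]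
    · show χ ((1, Multiplicative.ofAdd a, Multiplicative.ofAdd b) * (twistKK k 2)⁻¹) = true ↔
        χ (Multiplicative.ofAdd 1, Multiplicative.ofAdd a, Multiplicative.ofAdd (b - 1)) = true
      rw [h2]
    · show χ ((1, Multiplicative.ofAdd a, Multiplicative.ofAdd b) * (twistKK k 3)⁻¹) = true ↔
        χ (1, Multiplicative.ofAdd (a - 1), Multiplicative.ofAdd (b - 1)) = true
      rw [h3]
  rw [hv, card_filter_vec_eq_two_iff, chi_flip k χ hcm, chi_flip k χ hcm] at h
  have e1 := toNat_not_add (χ (1, Multiplicative.ofAdd (a - 1), Multiplicative.ofAdd b))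
  have e2 := toNat_not_add (χ (1, Multiplicative.ofAdd a, Multiplicative.ofAdd (b - 1)))
  unfold valKK
  omega

variable [NeZero k]

/-- `D(a, b) = g(a,b) − g(a−1,b)` is independent of `b`. -/
theorem valKK_diff_const (χ : PKK k → Bool)
    (hM : ∀ a b : ZMod k, valKK k χ a b - valKK k χ (a - 1) b - valKK k χ a (b - 1) +
      valKK k χ (a - 1) (b - 1) = 0) (a b b' : ZMod k) :
    valKK k χ a b - valKK k χ (a - 1) b = valKK k χ a b' - valKK k χ (a - 1) b' := by
  have hn : ∀ n : ℕ, valKK k χ a (b - n) - valKK k χ (a - 1) (b - n) =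
      valKK k χ a b - valKK k χ (a - 1) b := by
    intro n
    induction n with
    | zero => rw [Nat.cast_zero, sub_zero]
    | succ n ih =>
      have h := hM a (b - n)
      rw [Nat.cast_succ, ← sub_sub]
      omega
  have e : b' = b - ((b - b').val : ZMod k) := by rw [ZMod.natCast_zmod_val, sub_sub_cancel]
  rw [e]
  exact (hn _).symm

/-- `E(a, b) = g(a,b) − g(0,b)` is independent of `b`. -/
theorem valKK_sub_const (χ : PKK k → Bool)
    (hM : ∀ a b : ZMod k, valKK k χ a b - valKK k χ (a - 1) b - valKK k χ a (b - 1) +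
      valKK k χ (a - 1) (b - 1) = 0) (a b b' : ZMod k) :
    valKK k χ a b - valKK k χ 0 b = valKK k χ a b' - valKK k χ 0 b' := by
  have hn : ∀ n : ℕ, valKK k χ (n : ZMod k) b - valKK k χ 0 b =
      valKK k χ (n : ZMod k) b' - valKK k χ 0 b' := by
    intro n
    induction n with
    | zero => rw [Nat.cast_zero, sub_self, sub_self]
    | succ n ih =>
      have h := valKK_diff_const k χ hM ((n + 1 : ℕ) : ZMod k) b b'
      rw [Nat.cast_succ, add_sub_cancel_right] at h
      rw [Nat.cast_succ]
      omega
  have e : a = (a.val : ZMod k) := (ZMod.natCast_zmod_val a).symm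
  rw [e]
  exact hn a.val

/-- **Dichotomy.**  A `{0,1}`-valued `g` with vanishing mixed differences depends on `a` alone or on `b`
alone. -/
theorem valKK_dichotomy (χ : PKK k → Bool)
    (hM : ∀ a b : ZMod k, valKK k χ a b - valKK k χ (a - 1) b - valKK k χ a (b - 1) +
      valKK k χ (a - 1) (b - 1) = 0) :
    (∀ a b : ZMod k, valKK k χ a b = valKK k χ 0 b) ∨ (∀ a b : ZMod k, valKK k χ a b = valKK k χ a 0) := by
  by_cases h : ∀ a : ZMod k, valKK k χ a 0 = valKK k χ 0 0
  · left
    intro a b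
    have h1 := valKK_sub_const k χ hM a b 0
    have h2 := h a
    omega
  · right
    obtain ⟨a₀, ha₀⟩ : ∃ a : ZMod k, valKK k χ a 0 ≠ valKK k χ 0 0 := by
      by_contra h'
      exact h (fun a => by by_contra h''; exact h' ⟨a, h''⟩)
    intro a b
    have h1 := valKK_sub_const k χ hM a₀ b 0
    have h2 := valKK_sub_const k χ hM a b 0
    have b1 := valKK_bounds k χ a₀ 0
    have b2 := valKK_bounds k χ 0 0
    have b3 := valKK_bounds k χ a₀ b
    have b4 := valKK_bounds k χ 0 b
    omega

/-- **The local theorem.**  A pattern on `ℤ/2 × ℤ/k × ℤ/k` satisfying the CM condition and the local `SumTwo`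
of the two-generator rectangle has a conjugate pair: `Φ ψ(1,1,0) = c • Φ` (pair `(0, 1)`) or
`Φ ψ(1,0,1) = c • Φ` (pair `(0, 2)`). -/
theorem exists_conj_local_kk (χ : PKK k → Bool) (hcm : ∀ p : PKK k, χ (p * conjKK k) = !χ p)
    (hst : ∀ p : PKK k, (univ.filter fun j : Fin 4 => χ (p * (twistKK k j)⁻¹) = true).card = 2) :
    ∃ i j : Fin 4, ∀ p : PKK k,
      χ (p * (twistKK k j)⁻¹) = χ (p * (conjKK k * (twistKK k i)⁻¹)) := by
  have hM := valKK_mixed k χ hcm hst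
  -- the conjugate translate
  have t0c : ∀ p : PKK k, p * (conjKK k * (twistKK k 0)⁻¹) = (p.1 * Multiplicative.ofAdd 1, p.2.1, p.2.2) := by
    rintro ⟨s, a, b⟩
    show ((s, a, b) : PKK k) * ((Multiplicative.ofAdd 1, 1, 1) * (1, 1, 1)⁻¹) =
      (s * Multiplicative.ofAdd 1, a, b)
    simp only [Prod.inv_mk, inv_one, Prod.mk_mul_mk, mul_one]
  rcases valKK_dichotomy k χ hM with hA | hB
  · -- independent of `a`: pair `(0, 1)`
    refine ⟨0, 1, ?_⟩
    rintro ⟨s, a, b⟩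
    have h1 := (mul_twistKK_inv k s a b).2.1
    rw [zmod2_ofAdd_neg_one] at h1
    rw [h1, t0c]
    have key : χ (1, a * Multiplicative.ofAdd (-1), b) = χ (1, a, b) := by
      apply eq_of_toNat_eq
      have e1 := hA (Multiplicative.toAdd a - 1) (Multiplicative.toAdd b)
      have e2 := hA (Multiplicative.toAdd a) (Multiplicative.toAdd b)
      unfold valKK at e1 e2
      rw [ofAdd_sub, div_eq_mul_inv, ofAdd_toAdd, ofAdd_toAdd] at e1
      rw [ofAdd_toAdd, ofAdd_toAdd] at e2
      rw [show a * Multiplicative.ofAdd (-1) = a * (Multiplicative.ofAdd 1)⁻¹ by rw [ofAdd_neg]]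
      omega
    rcases zmod2_cases s with rfl | rfl
    · rw [one_mul, chi_flip k χ hcm, chi_flip k χ hcm, key]
    · rw [zmod2_ofAdd_one_sq, key]
  · -- independent of `b`: pair `(0, 2)`
    refine ⟨0, 2, ?_⟩
    rintro ⟨s, a, b⟩
    have h2 := (mul_twistKK_inv k s a b).2.2.1
    rw [zmod2_ofAdd_neg_one] at h2
    rw [h2, t0c]
    have key : χ (1, a, b * Multiplicative.ofAdd (-1)) = χ (1, a, b) := by
      apply eq_of_toNat_eq
      have e1 := hB (Multiplicative.toAdd a) (Multiplicative.toAdd b - 1)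
      have e2 := hB (Multiplicative.toAdd a) (Multiplicative.toAdd b)
      unfold valKK at e1 e2
      rw [ofAdd_sub, div_eq_mul_inv, ofAdd_toAdd, ofAdd_toAdd] at e1
      rw [ofAdd_toAdd, ofAdd_toAdd] at e2
      rw [show b * Multiplicative.ofAdd (-1) = b * (Multiplicative.ofAdd 1)⁻¹ by rw [ofAdd_neg]]
      omega
    rcases zmod2_cases s with rfl | rfl
    · rw [one_mul, chi_flip k χ hcm, chi_flip k χ hcm, key]
    · rw [zmod2_ofAdd_one_sq, key]

end Local

/-- `|ℤ/2 × ℤ/k × ℤ/k| = 2k²`. -/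
theorem card_PKK (k : ℕ) [NeZero k] : Fintype.card (PKK k) = 2 * (k * k) := by
  simp only [Fintype.card_prod, Fintype.card_multiplicative, ZMod.card]

/-- **The threshold.**  A two-generator rectangle quadruple `Φ, Φ ψ(1,1,0), Φ ψ(1,0,1), Φ ψ(0,1,1)`
(`ψ : ℤ/2 × ℤ/k × ℤ/k →* G` injective with `ψ(1,0,0) = c`) that is `SumTwo` without a conjugate pair forces
`4k² ≤ |G|`. -/
theorem four_mul_sq_le_card_of_rectQuad_kk [Fintype G] [DecidableEq G] (k : ℕ) [NeZero k]
    (ψ : PKK k →* G) (hψ : Function.Injective ψ) {c : G} (hc : IsComplexConj c) (hψc : ψ (conjKK k) = c)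
    {Φ : Finset G} (hΦ : IsCMType c Φ) (hs : SumTwo (fun i => rmul Φ (ψ (twistKK k i))))
    (hnc : ∀ i j : Fin 4, rmul Φ (ψ (twistKK k j)) ≠ c • rmul Φ (ψ (twistKK k i))) :
    4 * (k * k) ≤ Fintype.card G := by
  -- Lagrange: `2k² ∣ |G|`
  have hdvd : 2 * (k * k) ∣ Fintype.card G := by
    have h := Subgroup.card_subgroup_dvd_card ψ.range
    rw [← Nat.card_congr (MonoidHom.ofInjective hψ).toEquiv, Nat.card_eq_fintype_card,
      Nat.card_eq_fintype_card, card_PKK] at h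
    exact h
  by_contra hlt
  rw [not_le] at hlt
  -- so `|G| = 2k²` and `ψ` is bijective
  have hcard : Fintype.card G = 2 * (k * k) := by
    obtain ⟨m, hm⟩ := hdvd
    have hpos : 0 < Fintype.card G := Fintype.card_pos
    have hk0 : 0 < k := Nat.pos_of_ne_zero (NeZero.ne k)
    have : m = 1 := by
      rcases Nat.lt_or_ge m 2 with h | h
      · interval_cases m
        · omega
        · rfl
      · have h2 : 2 * (k * k) * 2 ≤ 2 * (k * k) * m := Nat.mul_le_mul_left (2 * (k * k)) h
        omega
    rw [hm, this, mul_one]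
  have hbij : Function.Bijective ψ :=
    (Fintype.bijective_iff_injective_and_card ψ).2 ⟨hψ, by rw [card_PKK, hcard]⟩
  -- the pattern `χ p = [ψ p ∈ Φ]`
  let χ : PKK k → Bool := fun p => decide (ψ p ∈ Φ)
  have hcm : ∀ p : PKK k, χ (p * conjKK k) = !χ p := by
    intro p
    show decide (ψ (p * conjKK k) ∈ Φ) = !decide (ψ p ∈ Φ)
    rw [map_mul, hψc, ← hc.comm, ← decide_not]
    congr 1
    exact propext (hΦ.conj_mem_iff (ψ p))
  have hst : ∀ p : PKK k, (univ.filter fun j : Fin 4 => χ (p * (twistKK k j)⁻¹) = true).card = 2 := by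
    intro p
    have := hs (ψ p)
    refine Eq.trans ?_ this
    congr 1
    apply Finset.filter_congr
    intro j _
    show decide (ψ (p * (twistKK k j)⁻¹) ∈ Φ) = true ↔ ψ p ∈ rmul Φ (ψ (twistKK k j))
    rw [mem_rmul, map_mul, map_inv, decide_eq_true_iff]
  obtain ⟨i, j, hij⟩ := exists_conj_local_kk k χ hcm hst
  apply hnc i j
  ext x
  obtain ⟨p, rfl⟩ := hbij.2 x
  have h := hij p
  simp only [χ] at h
  rw [mem_rmul, hc.mem_smul_iff, mem_rmul, hc.comm]
  have key1 : ψ p * (ψ (twistKK k j))⁻¹ = ψ (p * (twistKK k j)⁻¹) := by rw [map_mul, map_inv]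
  have key2 : ψ p * c * (ψ (twistKK k i))⁻¹ = ψ (p * (conjKK k * (twistKK k i)⁻¹)) := by
    rw [map_mul, map_mul, map_inv, hψc, mul_assoc]
  rw [key1, key2, ← decide_eq_true_iff (p := ψ (p * (twistKK k j)⁻¹) ∈ Φ),
    ← decide_eq_true_iff (p := ψ (p * (conjKK k * (twistKK k i)⁻¹)) ∈ Φ), h]

/-- **The two-generator rectangle criterion.**  Given `ψ : ℤ/2 × ℤ/k × ℤ/k →* G` injective with `ψ(1,0,0) = c`
and `k ≥ 3`, a CM type whose twists by `1, ψ(1,1,0), ψ(1,0,1), ψ(0,1,1)` are `SumTwo` without a conjugate pair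
exists IFF `4k² ≤ |G|`. -/
theorem exists_rectQuad_kk_iff [Fintype G] [DecidableEq G] (k : ℕ) [NeZero k] (ψ : PKK k →* G)
    (hψ : Function.Injective ψ) {c : G} (hc : IsComplexConj c) (hψc : ψ (conjKK k) = c) (hk : 3 ≤ k) :
    (∃ Φ : Finset G, IsCMType c Φ ∧ SumTwo (fun i => rmul Φ (ψ (twistKK k i))) ∧
      ∀ i j : Fin 4, rmul Φ (ψ (twistKK k j)) ≠ c • rmul Φ (ψ (twistKK k i))) ↔
      4 * (k * k) ≤ Fintype.card G :=
  ⟨fun ⟨_, hΦ, hs, hnc⟩ => four_mul_sq_le_card_of_rectQuad_kk k ψ hψ hc hψc hΦ hs hnc,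
    fun h => exists_rectQuad_kk k ψ hψ hc hψc hk h⟩

end HodgeRepro.CosetQuad
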